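import Literature.AlgebraicGeometry.AbelianSchemes.AbelianSchemeTheoremOfSquareOfDualPair
import Literature.AlgebraicGeometry.AbelianSchemes.AbelianSchemeTheoremOfCubeLocallyNoetherian
import HarnessLib

/-!
# `Λ(L) : A → Â` commutes with base change, in the relation form: for a base-change square `(G, Ĝ)` of an abelian scheme
# WITH its dual pair, `Λ(G^*L) ≫ Ĝ = G ≫ Λ(L)` ([MumfordAV1970] §8/§13; [MumfordFogartyKirwan1994] Ch. 6 §1 Cor. 6.8, §2 Def. 6.2)

Layer `Literature/AlgebraicGeometry/AbelianSchemes`, namespace `Literature.AlgebraicGeometry.AbelianSchemes.AbelianSchemeOver`.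
THEOREMS ONLY (no definition, no named fact, no instance, no notation, no `sorry`).  Cell `hodgecm-mathlib` (D-0151 / D-0183
FLOOR 0), programme P1 sub-line F-11 (`Cruxes/HDel/Lines/F11SmoothRoadA.lean`, stub `stub_polarizedLift`, v1 cut α piece α3
step (iv); B-p05 (g19) cut note v2).  Count-neutral capital; HC_CM is proved only modulo the 7 printed citations until rung 0
closes, and nothing here is about HC.

THE PRINT.  [MumfordAV1970] §8 (pp. 74–75) / §13: `Λ(L) : X → X̂`, `x ↦ [T_x^*L ⊗ L⁻¹]`, is the morphism classifying the
Mumford family `m^*L ⊗ p₁^*L⁻¹ ⊗ p₂^*L⁻¹` through the universal property of `(X̂, 𝒫)`; [MumfordFogartyKirwan1994] Ch. 6 §1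
Cor. 6.8 (p. 118) / remark after Def. 7.5 (p. 130): the dual abelian scheme and its Poincaré sheaf are compatible with base
change, `(X ×_S T)^ = X̂ ×_S T`, «`ϖ × 1_T` is the polarization of `X ×_S T`».  Hence `Λ` of a pulled-back line bundle is the
pull-back of `Λ`: for a base-change square `G : A′ = A ×_S S′ → A` with dual transport `Ĝ : Â′ → Â` (Poincaré clause
`(G × Ĝ)^*𝒫 ≅ 𝒫′`), `Λ(G^*L) ≫ Ĝ = G ≫ Λ(L)`.  In the tree, `Λ(L)` over a base is any morphism with the classifying property (ii)
of ★ `exists_isMonHom_classify_mumfordBundle` («`(1_A × (u ≫ λ_L))^*𝒫 ≅ Λ(L)|_u` for all `u`»); this file proves the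
compatibility for such morphisms on both sides, by UNIQUENESS in the universal property of `D′` (★ `DualPair.eq_of_nonempty_iso`)
— the candidate `Â′`-valued morphism obtained from `G ≫ Λ(L)` through the cartesian square of `Ĝ` classifies the same family
`Λ(G^*L)` as `Λ(G^*L)` itself: `(1 × ρ)^*𝒫′ = (1 × ρ)^*(G × Ĝ)^*𝒫 = (G × G)^*(1 × Λ(L))^*𝒫 = (G × G)^*Λ(L) = Λ(G^*L)`, checked
on determinant classes (★ `nonempty_iso_iff_detClass_eq`, ★ `IsBaseChangeVia.pullback_lift_left_mumfordClass_pullback`).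

* `IsBaseChangeVia.classifyMumford_left_comp_eq` — the head: `lam′.left ≫ Ĝ = G ≫ lam.left` for `lam`, `lam′` with property (ii)
  w.r.t. `D`, `D′`, along `(G, Ĝ)` with the Poincaré clause; `L` of rank one, rigidified along `ε_A`.
* USE (F-11 α3, step (iv)): with `lam := Λ(L)` on the lift and `lam′ := Λ(G^*L) = λ₀·λ₀` over `A⧸J` (★
  `eq_mul_self_of_classify_mumfordBundle_LDelta`), the divided `λ` (`Λ(L) = [2] ≫ λ`, ★-in-HOME `HomKillsTorsionOfThickening`)
  satisfies the `λ`-clause `λ₀ ≫ Ĝ = G ≫ λ` of ★ `IsBaseChangeVia` by uniqueness of division (`[2]` an epimorphism).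

## References
* [MumfordAV1970] D. Mumford, *Abelian Varieties* (1970), §8 (pp. 74–75), §13 (p. 123).
* [MumfordFogartyKirwan1994] D. Mumford, J. Fogarty, F. Kirwan, *Geometric Invariant Theory*, 3rd ed. (1994), Ch. 6 §1
  Cor. 6.8 (p. 118), §2 Def. 6.2 (p. 120); Ch. 7 §2 remark after Def. 7.5 (p. 130).
* [MilneAV2008] J. S. Milne, *Abelian Varieties* (2008), I §8 pp. 36–37 (uniqueness in the universal property).
-/

-- `(A.X ⊗ T).left = pullback A.X.hom T.hom`, `A.prodLeft B = pullback A.X.hom B.X.hom` hold by `rfl` at default transparency.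
set_option backward.isDefEq.respectTransparency false

noncomputable section

open CategoryTheory CategoryTheory.Limits AlgebraicGeometry MonoidalCategory CartesianMonoidalCategory
open scoped MonObj

universe u

namespace Literature.AlgebraicGeometry.AbelianSchemes

open Literature.AlgebraicGeometry.Motives Literature.AlgebraicGeometry.Modules
  Literature.AlgebraicGeometry.AbelianVarieties

namespace AbelianSchemeOver

variable {S S' : Scheme.{u}} {A' : AbelianSchemeOver S'} {A : AbelianSchemeOver S} {g : S' ⟶ S}
  {G : A'.X.left ⟶ A.X.left}

/-- The class of the Mumford family classified by a morphism with property (ii) of ★ `exists_isMonHom_classify_mumfordBundle`,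
read at `u = 𝟙_A`: `[(1_A × lam)^*𝒫] = [Λ(L)]` on `A ×_S A`. [cite: MumfordAV1970, §8 (pp. 74–75)] -/
private theorem detClass_pullbackP_classifyMumford {L : A.left.Modules} (hL : HasRank L 1) (D : A.DualPair)
    (lam : A.X ⟶ D.hat.X)
    (hlam : ∀ {T : Over S} (u : T ⟶ A.X), Nonempty (D.pullbackP T.hom (u ≫ lam).left (Over.w _) ≅
      (Scheme.Modules.pullback (A.X ◁ u).left).obj (A.mumfordBundle L))) :
    CechPic.pullback (A.baseChangeToProd D.hat A.X.hom lam.left (Over.w lam))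
        (detClass (HasRank.isFiniteLocallyFree' D.hasRank_one)) =
      A.mumfordClass (detClass (HasRank.isFiniteLocallyFree' hL)) := by
  have hP₁ := HasRank.isFiniteLocallyFree' D.hasRank_one
  have hΛ := A.hasRank_mumfordBundle hL
  have hΛ₁ := HasRank.isFiniteLocallyFree' hΛ
  obtain ⟨i⟩ := hlam (𝟙 A.X)
  -- `(𝟙 ≫ lam).left = lam.left` and `(A ◁ 𝟙).left = 𝟙`
  have h1 : (𝟙 A.X ≫ lam).left = lam.left := by rw [Category.id_comp]
  have h2 : (A.X ◁ 𝟙 A.X).left = 𝟙 _ := by rw [MonoidalCategory.whiskerLeft_id]; rfl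
  have e : D.pullbackP A.X.hom lam.left (Over.w lam) ≅
      (Scheme.Modules.pullback (𝟙 (A.X ⊗ A.X).left)).obj (A.mumfordBundle L) :=
    eqToIso (D.pullbackP_congr A.X.hom h1.symm (Over.w lam) (Over.w _)) ≪≫ i ≪≫
      eqToIso (congrArg (fun x => (Scheme.Modules.pullback x).obj (A.mumfordBundle L)) h2)
  have key := detClass_eq_of_iso e (hP₁.pullback _) (hΛ₁.pullback _)
  rw [detClass_pullback _ hP₁, detClass_pullback _ hΛ₁] at key
  erw [CechPic.pullback_id_apply] at key
  rw [A.detClass_mumfordBundle hL hΛ₁] at key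
  exact key

/-- **`Λ` COMMUTES WITH BASE CHANGE (relation form): `Λ(G^*L) ≫ Ĝ = G ≫ Λ(L)`.**  Let `G : A′ → A` over `g : S′ → S` be a
base-change square of group schemes (★ `IsBaseChangeVia`) with `S′` locally Noetherian, `D = (Â, 𝒫)`, `D′ = (Â′, 𝒫′)` dual pairs,
`Ĝ : Â′ → Â` a base-change square over `g` with the POINCARÉ CLAUSE `(G × Ĝ)^*𝒫 ≅ 𝒫′` (the clauses of ★
`PolarizedAbelianSchemeWithLevel.IsBaseChangeVia`; e.g. `Ĝ` the dual transport ★ `hatTransportOfBaseChange`), `L` a line bundle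
on `A` rigidified along `ε_A`, and `lam : A → Â`, `lam′ : A′ → Â′` morphisms CLASSIFYING the Mumford families of `L` and of
`G^*L` (property (ii) of ★ `exists_isMonHom_classify_mumfordBundle`).  Then `lam′ ≫ Ĝ = G ≫ lam` on underlying schemes.
Proof: the `S′`-morphism `ρ : A′ → Â′` with `ρ ≫ Ĝ = G ≫ lam` (cartesian square of `Ĝ`) classifies the universal Mumford
family of `G^*L`, as does `lam′`; uniqueness in the universal property of `D′` (★ `DualPair.eq_of_nonempty_iso`).  The
isomorphism `(1 × ρ)^*𝒫′ ≅ Λ(G^*L)` is read on determinant classes: `(1 × ρ) ≫ (G × Ĝ) = (G × G) ≫ (1 × lam)`,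
`[(1 × lam)^*𝒫] = [Λ(L)]`, and `Λ([G^*L]) = (G × G)^*Λ([L])` (★ `pullback_lift_left_mumfordClass_pullback`).
[cite: MumfordFogartyKirwan1994, Ch. 6 §1 Cor. 6.8 (p. 118) and §2 Definition 6.2 (p. 120)] [cite: MumfordAV1970, §8 (pp. 74–75)]
[cite: MilneAV2008, I §8 pp. 36–37] -/
theorem IsBaseChangeVia.classifyMumford_left_comp_eq [IsLocallyNoetherian S'] (h : A'.IsBaseChangeVia A g G)
    (D : A.DualPair) (D' : A'.DualPair) {Ĝ : D'.hat.X.left ⟶ D.hat.X.left} (hĜ : D'.hat.IsBaseChangeVia D.hat g Ĝ)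
    (hP : Nonempty ((Scheme.Modules.pullback
      (pullback.map A'.X.hom D'.hat.X.hom A.X.hom D.hat.X.hom G Ĝ g h.fst.symm hĜ.fst.symm)).obj D.P ≅ D'.P))
    {L : A.left.Modules} (hL : HasRank L 1)
    (hε : CechPic.pullback A.unitSection (detClass (HasRank.isFiniteLocallyFree' hL)) = 1)
    (lam : A.X ⟶ D.hat.X)
    (hlam : ∀ {T : Over S} (u : T ⟶ A.X), Nonempty (D.pullbackP T.hom (u ≫ lam).left (Over.w _) ≅
      (Scheme.Modules.pullback (A.X ◁ u).left).obj (A.mumfordBundle L)))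
    (lam' : A'.X ⟶ D'.hat.X)
    (hlam' : ∀ {T' : Over S'} (u' : T' ⟶ A'.X), Nonempty (D'.pullbackP T'.hom (u' ≫ lam').left (Over.w _) ≅
      (Scheme.Modules.pullback (A'.X ◁ u').left).obj (A'.mumfordBundle ((Scheme.Modules.pullback G).obj L)))) :
    lam'.left ≫ Ĝ = G ≫ lam.left := by
  -- notation and the standard rank / local-freeness witnesses
  set L' : A'.left.Modules := (Scheme.Modules.pullback G).obj L with hL'def
  have hL₁ := HasRank.isFiniteLocallyFree' hL
  have hL' : HasRank L' 1 := hasRank_pullback _ hL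
  have hL'₁ := HasRank.isFiniteLocallyFree' hL'
  have hc' : detClass hL'₁ = CechPic.pullback G (detClass hL₁) := by rw [← detClass_pullback G hL₁]
  -- the rigidification of `G^*L` along `ε_{A′}` (unit clause of the square)
  have hε' : CechPic.pullback A'.unitSection (detClass hL'₁) = 1 := by
    rw [hc']
    exact h.pullback_unitSection_pullback_eq_one _ hε
  -- the universal Mumford family of `G^*L` on `A′ ×_{S′} A′`, rigidified and fibrewise in `Pic⁰`
  let ℒ' : A'.RigidifiedLineBundle A'.X.hom :=
    ⟨(Scheme.Modules.pullback (A'.baseChangeToProd A' A'.X.hom (𝟙 _) (Category.id_comp _))).obj (A'.mumfordBundle L'),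
      A'.hasRank_mumfordFamily hL' _ _ _, A'.rigid_mumfordFamily hL' hε' _ _ _⟩
  have hℒ' : ℒ'.FibrewisePicZero := A'.fibrewisePicZero_mumfordFamily hL' hε' _ _ _
  have hℒ'L : ℒ'.L = (Scheme.Modules.pullback (A'.X ◁ 𝟙 A'.X).left).obj (A'.mumfordBundle L') :=
    congrArg (fun x => (Scheme.Modules.pullback x).obj (A'.mumfordBundle L'))
      (A'.baseChangeToProd_eq_whiskerLeft_left A' (𝟙 A'.X))
  -- `lam′` classifies it (property (ii) at `u′ = 𝟙`)
  have hlam'w : lam'.left ≫ D'.hat.X.hom = A'.X.hom := Over.w lam'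
  have i₁ : Nonempty (D'.pullbackP A'.X.hom lam'.left hlam'w ≅ ℒ'.L) := by
    obtain ⟨i⟩ := hlam' (𝟙 A'.X)
    have h1 : (𝟙 A'.X ≫ lam').left = lam'.left := by rw [Category.id_comp]
    exact ⟨eqToIso (D'.pullbackP_congr A'.X.hom h1.symm hlam'w (Over.w _)) ≪≫ i ≪≫ eqToIso hℒ'L.symm⟩
  -- the candidate `ρ : A′ → Â′` with `ρ ≫ Ĝ = G ≫ lam` (cartesian square of `Ĝ`)
  have hρw : (G ≫ lam.left) ≫ D.hat.X.hom = A'.X.hom ≫ g := by rw [Category.assoc, Over.w lam, h.fst]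
  let ρ : A'.X.left ⟶ D'.hat.X.left := hĜ.snd.1.lift (G ≫ lam.left) A'.X.hom hρw
  have hρĜ : ρ ≫ Ĝ = G ≫ lam.left := hĜ.snd.1.lift_fst _ _ _
  have hρ : ρ ≫ D'.hat.X.hom = A'.X.hom := hĜ.snd.1.lift_snd _ _ _
  -- `ρ` classifies `ℒ′` too: on determinant classes
  have i₂ : Nonempty (D'.pullbackP A'.X.hom ρ hρ ≅ ℒ'.L) := by
    have hP₁ := HasRank.isFiniteLocallyFree' D.hasRank_one
    have hP'₁ := HasRank.isFiniteLocallyFree' D'.hasRank_one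
    have hrk : HasRank (D'.pullbackP A'.X.hom ρ hρ) 1 := hasRank_pullback _ D'.hasRank_one
    refine (nonempty_iso_iff_detClass_eq hrk ℒ'.hasRank_one (hP'₁.pullback _) (HasRank.isFiniteLocallyFree' ℒ'.hasRank_one)).2 ?_
    -- `[𝒫′] = (G × Ĝ)^*[𝒫]`
    obtain ⟨eP⟩ := hP
    have hPP : detClass hP'₁ =
        CechPic.pullback (pullback.map A'.X.hom D'.hat.X.hom A.X.hom D.hat.X.hom G Ĝ g h.fst.symm hĜ.fst.symm)
          (detClass hP₁) := by
      rw [← detClass_pullback _ hP₁]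
      exact (detClass_eq_of_iso eP (hP₁.pullback _) hP'₁).symm
    -- `(1 × ρ) ≫ (G × Ĝ) = (G × G) ≫ (1 × lam)`
    have hsq : A'.baseChangeToProd D'.hat A'.X.hom ρ hρ ≫
        pullback.map A'.X.hom D'.hat.X.hom A.X.hom D.hat.X.hom G Ĝ g h.fst.symm hĜ.fst.symm =
        pullback.map A'.X.hom A'.X.hom A.X.hom A.X.hom G G g h.fst.symm h.fst.symm ≫
          A.baseChangeToProd D.hat A.X.hom lam.left (Over.w lam) := by
      apply pullback.hom_ext
      · simp only [Category.assoc, pullback.lift_fst, baseChangeToProd_fst, baseChangeToProd_fst_assoc]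
      · simp only [Category.assoc, pullback.lift_snd, pullback.lift_snd_assoc, baseChangeToProd_snd,
          baseChangeToProd_snd_assoc, hρĜ]
    -- `Λ([G^*L]) = (G × G)^*Λ([L])` (transfer along the square, at the pair of projections)
    have hΛ : A'.mumfordClass (detClass hL'₁) =
        CechPic.pullback (pullback.map A'.X.hom A'.X.hom A.X.hom A.X.hom G G g h.fst.symm h.fst.symm)
          (A.mumfordClass (detClass hL₁)) := by
      have key := h.pullback_lift_left_mumfordClass_pullback (detClass hL₁) (fst A'.X A'.X) (snd A'.X A'.X)
      rw [lift_fst_snd, Over.id_left, CechPic.pullback_id_apply, ← hc'] at key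
      exact key.trans (congrArg (fun φ => CechPic.pullback φ (A.mumfordClass (detClass hL₁)))
        (by apply pullback.hom_ext <;> simp [IsBaseChangeVia.pushHom_left]))
    -- assemble
    have hℒ'det : detClass (HasRank.isFiniteLocallyFree' ℒ'.hasRank_one) = A'.mumfordClass (detClass hL'₁) := by
      have hΛ' := A'.hasRank_mumfordBundle hL'
      have hΛ'₁ := HasRank.isFiniteLocallyFree' hΛ'
      change detClass (HasRank.isFiniteLocallyFree' (A'.hasRank_mumfordFamily hL' A'.X.hom (𝟙 _) (Category.id_comp _))) = _
      rw [show detClass (HasRank.isFiniteLocallyFree' (A'.hasRank_mumfordFamily hL' A'.X.hom (𝟙 _) (Category.id_comp _))) =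
          detClass (hΛ'₁.pullback _) from rfl, detClass_pullback _ hΛ'₁, A'.baseChangeToProd_self_id]
      erw [CechPic.pullback_id_apply]
      rw [A'.detClass_mumfordBundle hL' hΛ'₁]
    change detClass (hP'₁.pullback (A'.baseChangeToProd D'.hat A'.X.hom ρ hρ)) = _
    rw [detClass_pullback _ hP'₁, hPP, ← CechPic.pullback_comp, hsq, CechPic.pullback_comp,
      A.detClass_pullbackP_classifyMumford hL D lam hlam, ← hΛ, hℒ'det]
  -- uniqueness in the universal property of `D′`
  have heq : ρ = lam'.left := D'.eq_of_nonempty_iso A'.X.hom ℒ' hℒ' ρ lam'.left hρ hlam'w i₂ i₁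
  rw [← heq, hρĜ]

end AbelianSchemeOver

end Literature.AlgebraicGeometry.AbelianSchemes

end
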